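import Summits.AtomisticToContinuum.HydrodynamicLimit.Theorems.BoxDissipativeWeakStrongRelativeEnergyStabilityDefs
import Literature.Analysis.FluidPDE.HardSphereFlowJointMeasurable
import HarnessLib

/-!
# Crux `RelativeEnergyStability` (stmt-AtomisticToContinuum-17653), line `registered`:
stub `stub_flowJointMeasurable` (S-J) — hard-sphere flows have a jointly measurable version on the good set

A hard-sphere flow `Φ` on `T³` (`HardSphereFlow`, Alexander's theorem as a hypothesis structure) only
records that every time-`t` map `Φ_t` is measurable; off the (measurable, invariant, conull) good set
`Φ.good` the flow is junk. The heart stub of the line swaps the expectation `E_P` with the time integral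
`∫₀ᵗ ds` of box functionals of `Φ_s z` (Fubini/Tonelli), which needs a JOINTLY measurable
`(s, z) ↦ Φ_s z`. We produce a measurable modification `Ψ : ℝ × Config → Config` agreeing with
`(t, z) ↦ Φ_t z` on `ℝ × Φ.good`: `Ψ (t, z) := Φ_t z` if `z ∈ Φ.good`, and `:= z` otherwise.

Proof: the tree already has the joint measurability of the flow on `Φ.good × ℝ` for the flat torus,
`HardSphereFlow.measurable_flow_prod_torus` (`Literature/Analysis/FluidPDE/HardSphereFlowJointMeasurable`:
dyadic approximation from the right + right-continuity of hard-sphere trajectories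
`IsHardSphereTrajectory.tendsto_nhdsGT` + `measurable_of_tendsto_metrizable`); we glue it with the
measurable junk branch along the measurable set `{p | p.2 ∈ Φ.good}` by `Measurable.dite`.
References: Cercignani–Illner–Pulvirenti 1994 §4.2, App. 4.A; Gallagher–Saint-Raymond–Texier 2013 §4.2.
-/

noncomputable section

namespace Summit.AtomisticToContinuum.HydrodynamicLimit.Theorems.RES

open MeasureTheory Filter Set Literature.MathematicalPhysics.KineticTheory Literature.Analysis.FluidPDE
open scoped Topology

/-- The restriction of `(t, z) ↦ Φ_t z` to the measurable cylinder `{p | p.2 ∈ Φ.good}` over the good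
set is measurable (from `HardSphereFlow.measurable_flow_prod_torus`, reindexing
`{p : ℝ × Config | p.2 ∈ Φ.good} → Φ.good × ℝ`). -/
theorem fj_measurable_restrict_flow {ε : ℝ} {n : ℕ}
    (Φ : HardSphereFlow (Literature.Analysis.FluidPDE.Torus.geometry (Fin 3)) ε n) :
    Measurable fun p : (Prod.snd ⁻¹' Φ.good : Set (ℝ × Config n (Fin 3) T3)) =>
      Φ.flow (p : ℝ × Config n (Fin 3) T3).1 (p : ℝ × Config n (Fin 3) T3).2 := by
  have hφ : Measurable fun p : (Prod.snd ⁻¹' Φ.good : Set (ℝ × Config n (Fin 3) T3)) =>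
      ((⟨(p : ℝ × Config n (Fin 3) T3).2, p.2⟩ : Φ.good), (p : ℝ × Config n (Fin 3) T3).1) :=
    ((measurable_snd.comp measurable_subtype_coe).subtype_mk).prodMk
      (measurable_fst.comp measurable_subtype_coe)
  exact Φ.measurable_flow_prod_torus.comp hφ

/-- **Hard-sphere flows on `T³` have a jointly measurable version on the good set** (stub S-J of the
line): there is a measurable `Ψ : ℝ × Config → Config` with `Ψ (t, z) = Φ_t z` for all `t` and all
`z ∈ Φ.good` (namely `Φ_t z` on the good set and the junk value `z` off it). -/
theorem stub_flowJointMeasurable :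
    ∀ (ε : ℝ) (n : ℕ) (Φ : HardSphereFlow (Literature.Analysis.FluidPDE.Torus.geometry (Fin 3)) ε n),
      ∃ Ψ : ℝ × Config n (Fin 3) T3 → Config n (Fin 3) T3, Measurable Ψ ∧
        ∀ (t : ℝ), ∀ z ∈ Φ.good, Ψ (t, z) = Φ.flow t z := by
  intro ε n Φ
  classical
  have hs : MeasurableSet (Prod.snd ⁻¹' Φ.good : Set (ℝ × Config n (Fin 3) T3)) :=
    measurable_snd Φ.measurableSet_good
  have hg : Measurable fun p : ((Prod.snd ⁻¹' Φ.good)ᶜ : Set (ℝ × Config n (Fin 3) T3)) =>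
      (p : ℝ × Config n (Fin 3) T3).2 :=
    measurable_snd.comp measurable_subtype_coe
  refine ⟨fun p => if hp : p ∈ (Prod.snd ⁻¹' Φ.good : Set (ℝ × Config n (Fin 3) T3)) then
      (fun q : (Prod.snd ⁻¹' Φ.good : Set (ℝ × Config n (Fin 3) T3)) =>
        Φ.flow (q : ℝ × Config n (Fin 3) T3).1 (q : ℝ × Config n (Fin 3) T3).2) ⟨p, hp⟩
      else (fun q : ((Prod.snd ⁻¹' Φ.good)ᶜ : Set (ℝ × Config n (Fin 3) T3)) =>
        (q : ℝ × Config n (Fin 3) T3).2) ⟨p, hp⟩,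
    Measurable.dite (fj_measurable_restrict_flow Φ) hg hs, ?_⟩
  intro t z hz
  have hp : (t, z) ∈ (Prod.snd ⁻¹' Φ.good : Set (ℝ × Config n (Fin 3) T3)) := hz
  simp only [hp, dif_pos]

end Summit.AtomisticToContinuum.HydrodynamicLimit.Theorems.RES

end
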